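import Summits.ValiantsHypothesis.ValiantsHypothesis.Theorems.LacunarySymmetroidMatrixDescartesDoorA26WallBubblingMixGram

/-!
# Wall bubbling for `DoorA26` — WEYL TRIPLES: THE SCHUR RIGIDITY IDENTITY (pure classes are quadratic in the mixed slots over the frame Gram)

HONEST FRAMING.  Chain lemmas toward `TripleStratum26` of `Cruxes/DoorA26/Lines/wall_bubbling_ConfluentDoor.lean` (rev 13; crux `DoorA26`,
stmt-ValiantsHypothesis-19979 — OPEN, typed, never asserted).  W1 seat val-sym-door-p2 g15 (#85).  ALGEBRA ONLY (def-free).  `(Sym₂(ℝ), polar)`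
is a non-degenerate 3-space; for a frame `T₀,T₁,T₂ ∈ Sym₂(ℝ)` with polar Gram `G = (polar(T_i,T_j))` and any symmetric `W, W′`:

* **`schur_rigidity`** — `det G · polar(W,W′) = Σ_{i,j} polar(W,T_i) · adj(G)_{ij} · polar(T_j,W′)` (when `det G ≠ 0` this is
  `polar(W,W′) = bᵀ G⁻¹ b′` — the letters `W` are determined by their pairings `b_i = polar(W,T_i)` with the frame; stated as a POLYNOMIAL identity,
  valid for every `G`; proof: coordinates + `Matrix.det_fin_three` / `Matrix.adjugate_fin_three` + `ring`);
* `abs_adjugate_le` — `|adj(G)_{ij}| ≤ 2α²` when `|G_kl| ≤ α`;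
* **`abs_det_mul_polar_le`** — `|det G| · |polar(W,W′)| ≤ 18 · α² · β · β′` when `|polar(W,T_i)| ≤ β`, `|polar(T_j,W′)| ≤ β′`.

USE (#87, the rigidity dichotomy of the Weyl-triple cluster limit): at a normalised limit whose sixth slot `M₅` of the class `2α` is alive, #84's
`tripleMoment_five` forces the frame Gram to outgrow the function scale `N` with `G/‖G‖ → ±K` (W1 #80's invertible cancelling pattern), so
`|det G| ≳ ‖G‖³` while the mixed slots keep `β, β′ ≤ N`: every pure class `polar(W_x,W_y) = O(N²/‖G‖) = o(N)` DIES.  Nothing here bears on `DoorA26`,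
`MatrixDescartes` (stmt-ValiantsHypothesis-18050) or `VP ≠ VNP`; `TripleStratum26`, (W), (M) OPEN.  `--supports stmt-ValiantsHypothesis-19979 --as helper`.
[folklore] Schur complement / Cramer in a non-degenerate quadratic space.  [this work] its role at a Weyl triple.
-/

-- `Summit.ValiantsHypothesis.ValiantsHypothesis.…` repeats a component by the D-0017 layout
-- (single-conjunct summit), which the `dupNamespace` linter flags; the name is mandated.
set_option linter.dupNamespace false

namespace Summit.ValiantsHypothesis.ValiantsHypothesis.Theorems.LacunarySymmetroidMatrixDescartes.WallBubbling

open Finset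
open Bubbling (polar polar_apply)
open scoped BigOperators

/-- **THE SCHUR RIGIDITY IDENTITY.**  For symmetric `T₀,T₁,T₂,W,W′`:
`det G · polar(W,W′) = Σ_{i,j} polar(W,T_i)·adj(G)_{ij}·polar(T_j,W′)`, `G_{ij} = polar(T_i,T_j)`. [folklore] -/
theorem schur_rigidity (T : Fin 3 → Matrix (Fin 2) (Fin 2) ℝ) (hT : ∀ i, (T i).IsSymm) (W W' : Matrix (Fin 2) (Fin 2) ℝ)
    (hW : W.IsSymm) (hW' : W'.IsSymm) :
    (Matrix.of fun i j : Fin 3 => polar (T i) (T j)).det * polar W W'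
      = ∑ i : Fin 3, ∑ j : Fin 3, polar W (T i) * (Matrix.of fun i j : Fin 3 => polar (T i) (T j)).adjugate i j * polar (T j) W' := by
  -- coordinates of the symmetric letters
  have hG : (Matrix.of fun i j : Fin 3 => polar (T i) (T j))
      = Matrix.of fun i j : Fin 3 => (T i 0 0 * T j 1 1 + T j 0 0 * T i 1 1 - 2 * T i 0 1 * T j 0 1) / 2 := by
    ext i j; simp only [Matrix.of_apply, polar_apply_symm _ _ (hT i) (hT j)]
  have hWT : ∀ i, polar W (T i) = (W 0 0 * T i 1 1 + T i 0 0 * W 1 1 - 2 * W 0 1 * T i 0 1) / 2 :=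
    fun i => polar_apply_symm _ _ hW (hT i)
  have hTW : ∀ j, polar (T j) W' = (T j 0 0 * W' 1 1 + W' 0 0 * T j 1 1 - 2 * T j 0 1 * W' 0 1) / 2 :=
    fun j => polar_apply_symm _ _ (hT j) hW'
  rw [hG, polar_apply_symm _ _ hW hW', Fin.sum_univ_three, Fin.sum_univ_three, Fin.sum_univ_three, Fin.sum_univ_three,
    hWT, hWT, hWT, hTW, hTW, hTW, Matrix.det_fin_three, Matrix.adjugate_fin_three]
  simp only [Matrix.of_apply, Matrix.cons_val', Matrix.cons_val_zero, Matrix.cons_val_one, Matrix.cons_val_two,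
    Matrix.empty_val', Matrix.cons_val_fin_one, Matrix.vecHead, Matrix.vecTail, Fin.isValue, Function.comp_apply,
    Fin.succ_zero_eq_one]
  ring

/-- Entries of the adjugate of a `3 × 3` matrix are bounded by `2α²` when the entries are bounded by `α`. [folklore] -/
theorem abs_adjugate_le (G : Matrix (Fin 3) (Fin 3) ℝ) (α : ℝ) (hG : ∀ k l, |G k l| ≤ α) (i j : Fin 3) :
    |G.adjugate i j| ≤ 2 * α ^ 2 := by
  have hα : 0 ≤ α := (abs_nonneg _).trans (hG 0 0)
  have hprod : ∀ a b c d : Fin 3, |G a b * G c d| ≤ α ^ 2 := by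
    intro a b c d
    rw [abs_mul, sq]
    exact mul_le_mul (hG a b) (hG c d) (abs_nonneg _) hα
  have hXY : ∀ X Y : ℝ, |X| ≤ α ^ 2 → |Y| ≤ α ^ 2 → |X - Y| ≤ 2 * α ^ 2 :=
    fun X Y hX hY => (abs_sub X Y).trans (by linarith)
  rw [Matrix.adjugate_fin_succ_eq_det_submatrix, Matrix.det_fin_two, abs_mul, abs_pow, abs_neg, abs_one, one_pow, one_mul]
  simp only [Matrix.submatrix_apply]
  exact hXY _ _ (hprod _ _ _ _) (hprod _ _ _ _)

/-- **RIGIDITY BOUND.**  `|det G|·|polar(W,W′)| ≤ 18·α²·β·β′` when `|G_kl| ≤ α`, `|polar(W,T_i)| ≤ β`, `|polar(T_j,W′)| ≤ β′`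
(symmetric letters). [this work] -/
theorem abs_det_mul_polar_le (T : Fin 3 → Matrix (Fin 2) (Fin 2) ℝ) (hT : ∀ i, (T i).IsSymm) (W W' : Matrix (Fin 2) (Fin 2) ℝ)
    (hW : W.IsSymm) (hW' : W'.IsSymm) (α β β' : ℝ)
    (hG : ∀ k l, |polar (T k) (T l)| ≤ α) (hβ : ∀ i, |polar W (T i)| ≤ β) (hβ' : ∀ j, |polar (T j) W'| ≤ β') :
    |(Matrix.of fun i j : Fin 3 => polar (T i) (T j)).det| * |polar W W'| ≤ 18 * α ^ 2 * β * β' := by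
  have hβ0 : 0 ≤ β := (abs_nonneg _).trans (hβ 0)
  have hβ'0 : 0 ≤ β' := (abs_nonneg _).trans (hβ' 0)
  have hadj : ∀ i j, |(Matrix.of fun i j : Fin 3 => polar (T i) (T j)).adjugate i j| ≤ 2 * α ^ 2 :=
    abs_adjugate_le _ α (fun k l => by simpa [Matrix.of_apply] using hG k l)
  rw [← abs_mul, schur_rigidity T hT W W' hW hW']
  calc |∑ i : Fin 3, ∑ j : Fin 3, polar W (T i) * (Matrix.of fun i j : Fin 3 => polar (T i) (T j)).adjugate i j * polar (T j) W'|
      ≤ ∑ i : Fin 3, |∑ j : Fin 3, polar W (T i) * (Matrix.of fun i j : Fin 3 => polar (T i) (T j)).adjugate i j * polar (T j) W'| :=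
        Finset.abs_sum_le_sum_abs _ _
    _ ≤ ∑ i : Fin 3, ∑ j : Fin 3, |polar W (T i) * (Matrix.of fun i j : Fin 3 => polar (T i) (T j)).adjugate i j * polar (T j) W'| :=
        Finset.sum_le_sum fun i _ => Finset.abs_sum_le_sum_abs _ _
    _ ≤ ∑ _i : Fin 3, ∑ _j : Fin 3, β * (2 * α ^ 2) * β' := by
        refine Finset.sum_le_sum fun i _ => Finset.sum_le_sum fun j _ => ?_
        rw [abs_mul, abs_mul]
        exact mul_le_mul (mul_le_mul (hβ i) (hadj i j) (abs_nonneg _) hβ0) (hβ' j) (abs_nonneg _)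
          (mul_nonneg hβ0 (by positivity))
    _ = 18 * α ^ 2 * β * β' := by simp only [Finset.sum_const, Finset.card_univ, Fintype.card_fin, nsmul_eq_mul]; ring

end Summit.ValiantsHypothesis.ValiantsHypothesis.Theorems.LacunarySymmetroidMatrixDescartes.WallBubbling
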